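import Literature.MathematicalPhysics.QuantumLattice.TIVariationalPressure
import Literature.MathematicalPhysics.QuantumLattice.HubbardTTPrimeKinematicRowsAllFillings
import Literature.MathematicalPhysics.QuantumLattice.HubbardTTPrimeTPPFillingTransport
import HarnessLib

/-!
# `T > 0` words for the `t–t'–t''` family from `t–t'` certificates: the variational pressure of the grand-canonical
# `t–t'–t''` Hubbard interaction is convex and `(16/π²)`-Lipschitz in `t''`, hence within `β(16/π²)|t''|` of the certified
# `t–t'` pressure

Topic `Literature/MathematicalPhysics/QuantumLattice` (family `hubbard`); the first FAMILY instance of `TIVariationalPressure` (the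
`T > 0` twin of `HubbardTTPrimeTPPKinematicLipschitz` / `HubbardTTPrimeKinematicRowsAllFillings`, which give the `T = 0` words for
object M, the axial third-neighbour hopping `t''`):

* `gcInteractionTT'T'' t t' t'' U μ h = (Φ(t,t',U) − μn − hm) + t''·Φ''(1)` (a pencil in `t''`); its mean energy at range `2` is
  `u(ω) + t''·K₃(ω)` (`meanEnergy_gcInteractionTT'T''`), and at `t'' = 0` / range `2` the variational pressure is the `t–t'` one
  (`varPressure_gcInteractionTT'_two_eq`, range glue `meanEnergy_hubbardTTPrime_eq_one`).
* **`convexOn_varPressure_tpp`**: `t'' ↦ P(β; t,t',t'',U; μ,h)` is convex on `ℝ`.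
* **`abs_varPressure_tpp_sub_le`**: `|P(β;…,t'',…) − P(β;…,s'',…)| ≤ |β|·(16/π²)·|t'' − s''|` — the all-fillings kinematic row
  `|K₃(ω)| ≤ 16/π²` of every translation-invariant state (`…abs_meanEnergy_axialRange2Hopping_le_of_any_density`);
  **`abs_varPressure_tpp_sub_gcPressureTT'Zeeman_le`**: `|P(β; t,t',t'',U; μ,h) − gcPressureTT'Zeeman β t t' U μ h| ≤ |β|(16/π²)|t''|`
  (`β ≥ 0`, `U ≥ 0`) and the certificate form `varPressure_tpp_mem_Icc_of_window` (a certified `t–t'` pressure window `[W, Q]` gives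
  `[W − β(16/π²)|t''|, Q + β(16/π²)|t''|]` for the `t''` model).
* equilibrium states of the `t''` model (`IsVarEquilibrium`): the `K₃` Griffiths bracket from pressures at two values of `t''`
  (`IsVarEquilibrium.mul_axialRange2Hopping_le_varPressure_sub`), in particular from the `t–t'` pressure:
  `β t''·K₃(ω) ≤ gcPressureTT'Zeeman − P(t'')` (`…_gcPressureTT'Zeeman_sub`).

Everything is PROVED; definition with body: `gcInteractionTT'T''`; no named fact, no number. HONEST SCOPE: `P` is the VARIATIONAL pressure
of `TIVariationalPressure` (Araki–Moriya's `sup[s − βe]`); its identification with a limit of `t''`-torus partition functions is not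
claimed here (no `t''` producer exists at `T > 0`); the words above are nevertheless unconditional statements about that supremum.

## Mathlib / tree search

REUSED: `FermionInteraction.varPressure`, `sub_mul_le_varPressure`, `varPressure_le`, `abs_varPressure_sub_le`, `varPressure_gcInteractionTT'_eq`,
`meanEnergy_gcInteractionTT'`, `IsVarEquilibrium.varPressure_add_le` (`TIVariationalPressure`); `FermionInteraction.pencil`, `meanEnergy_pencil`
(`TIGroundEnergyDensityResponse`); `axialRange2HoppingFermionInteraction` (`HubbardThirdNeighbourHoppingInteraction`);
`IsTranslationInvariant.abs_meanEnergy_axialRange2Hopping_le_of_any_density` (`HubbardTTPrimeKinematicRowsAllFillings`);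
`meanEnergy_hubbardTTPrime_eq_one` (`HubbardTTPrimeTPPFillingTransport`). `lean search 'varPressure.*tpp|T''.*pressure'` (2026-08-27): nothing.

## References

* R. B. Israel, *Convexity in the Theory of Lattice Gases* (1979), Thm. I.3.4 (convexity and Lipschitz continuity of the pressure in
  the interaction). [cite: Israel1979, Thm. I.3.4]
* E. Pavarini et al., Phys. Rev. Lett. 87 (2001) 047003, eq. (1) (the `t–t'–t''` one-band model). [cite: PavariniEtAl2001, eq. (1)]
* E. H. Lieb, M. Loss, Duke Math. J. 71 (1993) 337, §8 Thm. 8.2 (the kinematic hopping bound). [cite: LiebLoss1993, §8, Theorem 8.2]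
-/

noncomputable section

open scoped ComplexOrder BigOperators
open Finset Literature.InformationTheory.Entropy

namespace Literature.MathematicalPhysics.QuantumLattice

open Matrix HubbardWave0 Literature.Probability.LatticeModels ThermodynamicLimit
open _root_.Filter
open scoped _root_.Topology

/-- **The grand-canonical `t–t'–t''` Hubbard interaction** `(Φ(t,t',U) − μn − hm) + t''·Φ''(1)`, a pencil in `t''`.
[cite: PavariniEtAl2001, eq. (1)] -/
def gcInteractionTT'T'' (t t' t'' U μ hz : ℝ) : FermionInteraction 2 :=
  (gcInteractionTT' t t' U μ hz).pencil (axialRange2HoppingFermionInteraction 2 1) t''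

namespace InfVolFermionState

/-- Its mean energy at range `R`: `e_{GC(t,t',U;μ,h)}(ω) + t''·K₃(ω)`. [cite: PavariniEtAl2001, eq. (1)] -/
theorem meanEnergy_gcInteractionTT'T'' (ω : InfVolFermionState 2) (t t' t'' U μ hz R : ℝ) :
    ω.meanEnergy (gcInteractionTT'T'' t t' t'' U μ hz) R =
      ω.meanEnergy (gcInteractionTT' t t' U μ hz) R + t'' * ω.meanEnergy (axialRange2HoppingFermionInteraction 2 1) R := by
  rw [gcInteractionTT'T'', ω.meanEnergy_pencil]

/-- **Range glue**: the grand-canonical `t–t'` mean energy is the same at range `2` and range `1`.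
[cite: BratteliKishimotoRobinson1978, §3 (mean energy functional)] -/
theorem meanEnergy_gcInteractionTT'_two (ω : InfVolFermionState 2) (t t' U μ hz : ℝ) :
    ω.meanEnergy (gcInteractionTT' t t' U μ hz) 2 = ω.meanEnergy (gcInteractionTT' t t' U μ hz) 1 := by
  rw [ω.meanEnergy_gcInteractionTT', ω.meanEnergy_gcInteractionTT',
    ω.meanEnergy_hubbardTTPrime_eq_one t t' U (by norm_num : (1 : ℝ) ≤ 2)]

end InfVolFermionState

/-- **Range glue for the pressure**: `P(β, GC(t,t',U;μ,h))` at range `2` equals the one at range `1`.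
[cite: BratteliKishimotoRobinson1978, §3 (mean energy functional)] -/
theorem varPressure_gcInteractionTT'_two (β t t' U μ hz : ℝ) :
    (gcInteractionTT' t t' U μ hz).varPressure β 2 = (gcInteractionTT' t t' U μ hz).varPressure β 1 := by
  unfold FermionInteraction.varPressure
  exact congrArg sSup (Set.image_congr fun ω _ => by rw [ω.meanEnergy_gcInteractionTT'_two])

/-- **At `t'' = 0` (range `2`) the variational pressure is the certified `t–t'` grand-canonical pressure** (`β ≥ 0`, `U ≥ 0`).
[cite: Israel1979, Thm. I.3.4] -/
theorem varPressure_gcInteractionTT'_two_eq {β : ℝ} (hβ : 0 ≤ β) (t t' : ℝ) {U : ℝ} (hU : 0 ≤ U) (μ hz : ℝ) :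
    (gcInteractionTT' t t' U μ hz).varPressure β 2 = gcPressureTT'Zeeman β t t' U μ hz := by
  rw [varPressure_gcInteractionTT'_two, varPressure_gcInteractionTT'_eq hβ t t' hU μ hz]

/-- `t'' = 0`: the `t–t'–t''` interaction has the same mean energies as the `t–t'` one. [cite: PavariniEtAl2001, eq. (1)] -/
theorem varPressure_gcInteractionTT'T''_zero (β t t' U μ hz : ℝ) :
    (gcInteractionTT'T'' t t' 0 U μ hz).varPressure β 2 = (gcInteractionTT' t t' U μ hz).varPressure β 2 := by
  unfold FermionInteraction.varPressure
  exact congrArg sSup (Set.image_congr fun ω _ => by rw [ω.meanEnergy_gcInteractionTT'T'', zero_mul, add_zero])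

/-- **`t'' ↦ P(β; t,t',t'',U; μ,h)` is CONVEX** (a pencil of interactions; supremum of affine functions of `t''`).
[cite: Israel1979, Thm. I.3.4] -/
theorem convexOn_varPressure_tpp (β t t' U μ hz : ℝ) :
    ConvexOn ℝ Set.univ fun t'' : ℝ => (gcInteractionTT'T'' t t' t'' U μ hz).varPressure β 2 := by
  refine ⟨convex_univ, fun x _ y _ a b ha hb hab => ?_⟩
  simp only [smul_eq_mul]
  refine (gcInteractionTT'T'' t t' (a * x + b * y) U μ hz).varPressure_le β 2 fun ω hω => ?_
  have hx := (gcInteractionTT'T'' t t' x U μ hz).sub_mul_le_varPressure β 2 hω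
  have hy := (gcInteractionTT'T'' t t' y U μ hz).sub_mul_le_varPressure β 2 hω
  rw [ω.meanEnergy_gcInteractionTT'T''] at hx hy ⊢
  have e : ω.entropyDensitySup - β * (ω.meanEnergy (gcInteractionTT' t t' U μ hz) 2 +
      (a * x + b * y) * ω.meanEnergy (axialRange2HoppingFermionInteraction 2 1) 2) =
      a * (ω.entropyDensitySup - β * (ω.meanEnergy (gcInteractionTT' t t' U μ hz) 2 +
        x * ω.meanEnergy (axialRange2HoppingFermionInteraction 2 1) 2)) +
      b * (ω.entropyDensitySup - β * (ω.meanEnergy (gcInteractionTT' t t' U μ hz) 2 +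
        y * ω.meanEnergy (axialRange2HoppingFermionInteraction 2 1) 2)) := by
    linear_combination (ω.entropyDensitySup - β * ω.meanEnergy (gcInteractionTT' t t' U μ hz) 2) * hab.symm
  rw [e]
  exact add_le_add (mul_le_mul_of_nonneg_left hx ha) (mul_le_mul_of_nonneg_left hy hb)

/-- **`P` is `|β|(16/π²)`-Lipschitz in `t''`**: `|P(…,t'',…) − P(…,s'',…)| ≤ |β|·(16/π²)·|t'' − s''|` — the all-fillings kinematic row
`|K₃(ω)| ≤ 16/π²` of every translation-invariant state. [cite: LiebLoss1993, §8, Theorem 8.2] [cite: Israel1979, Thm. I.3.4] -/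
theorem abs_varPressure_tpp_sub_le (β t t' t'' s'' U μ hz : ℝ) :
    |(gcInteractionTT'T'' t t' t'' U μ hz).varPressure β 2 - (gcInteractionTT'T'' t t' s'' U μ hz).varPressure β 2| ≤
      |β| * (16 / Real.pi ^ 2 * |t'' - s''|) := by
  refine (gcInteractionTT'T'' t t' t'' U μ hz).abs_varPressure_sub_le β 2 _ 2 fun ω hω => ?_
  rw [ω.meanEnergy_gcInteractionTT'T'', ω.meanEnergy_gcInteractionTT'T'', add_sub_add_left_eq_sub, ← sub_mul, abs_mul,
    mul_comm]
  exact mul_le_mul_of_nonneg_right (hω.abs_meanEnergy_axialRange2Hopping_le_of_any_density) (abs_nonneg _)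

/-- **THE `t''` PRESSURE IS WITHIN `β(16/π²)|t''|` OF THE CERTIFIED `t–t'` PRESSURE**:
`|P(β; t,t',t'',U; μ,h) − gcPressureTT'Zeeman β t t' U μ h| ≤ |β|·(16/π²)·|t''|` (`β ≥ 0`, `U ≥ 0`). [cite: Israel1979, Thm. I.3.4] -/
theorem abs_varPressure_tpp_sub_gcPressureTT'Zeeman_le {β : ℝ} (hβ : 0 ≤ β) (t t' t'' : ℝ) {U : ℝ} (hU : 0 ≤ U) (μ hz : ℝ) :
    |(gcInteractionTT'T'' t t' t'' U μ hz).varPressure β 2 - gcPressureTT'Zeeman β t t' U μ hz| ≤ |β| * (16 / Real.pi ^ 2 * |t''|) := by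
  have h := abs_varPressure_tpp_sub_le β t t' t'' 0 U μ hz
  rw [varPressure_gcInteractionTT'T''_zero, varPressure_gcInteractionTT'_two_eq hβ t t' hU μ hz, sub_zero] at h
  exact h

/-- **Certificate form**: a certified window `W ≤ gcPressureTT'Zeeman ≤ Q` at `t'' = 0` gives
`W − β(16/π²)|t''| ≤ P(β; t,t',t'',U; μ,h) ≤ Q + β(16/π²)|t''|` for the `t''` model (`β ≥ 0`, `U ≥ 0`). [cite: Israel1979, Thm. I.3.4] -/
theorem varPressure_tpp_mem_Icc_of_window {β : ℝ} (hβ : 0 ≤ β) (t t' t'' : ℝ) {U : ℝ} (hU : 0 ≤ U) (μ hz : ℝ) {W Q : ℝ}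
    (hW : W ≤ gcPressureTT'Zeeman β t t' U μ hz) (hQ : gcPressureTT'Zeeman β t t' U μ hz ≤ Q) :
    (gcInteractionTT'T'' t t' t'' U μ hz).varPressure β 2 ∈
      Set.Icc (W - β * (16 / Real.pi ^ 2 * |t''|)) (Q + β * (16 / Real.pi ^ 2 * |t''|)) := by
  have h := abs_varPressure_tpp_sub_gcPressureTT'Zeeman_le hβ t t' t'' hU μ hz
  rw [abs_of_nonneg hβ] at h
  obtain ⟨h1, h2⟩ := abs_le.1 h
  exact ⟨by linarith, by linarith⟩

namespace InfVolFermionState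

/-- **The `K₃` Griffiths bracket for equilibrium states of the `t''` model**: if `ω` is a variational equilibrium state of the
grand-canonical `t–t'–t''` interaction at `(β; t,t',t'',U; μ,h)`, then for every `s''`:
`β (t'' − s'')·K₃(ω) ≤ P(s'') − P(t'')` (tangent inequality in the `t''` direction). [cite: Israel1979, Thm. I.2.4] -/
theorem IsVarEquilibrium.mul_axialRange2Hopping_le_varPressure_sub {β : ℝ} {t t' t'' U μ hz : ℝ} {ω : InfVolFermionState 2}
    (h : ω.IsVarEquilibrium β (gcInteractionTT'T'' t t' t'' U μ hz) 2) (s'' : ℝ) :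
    β * (t'' - s'') * ω.meanEnergy (axialRange2HoppingFermionInteraction 2 1) 2 ≤
      (gcInteractionTT'T'' t t' s'' U μ hz).varPressure β 2 - (gcInteractionTT'T'' t t' t'' U μ hz).varPressure β 2 := by
  have hm := h.varPressure_add_le β (gcInteractionTT'T'' t t' s'' U μ hz) 2
  rw [ω.meanEnergy_gcInteractionTT'T'', ω.meanEnergy_gcInteractionTT'T''] at hm
  nlinarith [hm]

/-- **In particular from the `t–t'` pressure** (`s'' = 0`; `β ≥ 0`, `U ≥ 0`):
`β t''·K₃(ω) ≤ gcPressureTT'Zeeman β t t' U μ h − P(β; t,t',t'',U; μ,h)` — with a certified `t–t'` pressure cap and any floor on the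
`t''` pressure this bounds the third-neighbour hopping energy of the equilibrium state. [cite: Israel1979, Thm. I.2.4] -/
theorem IsVarEquilibrium.mul_axialRange2Hopping_le_gcPressureTT'Zeeman_sub {β : ℝ} (hβ : 0 ≤ β) {t t' t'' U μ hz : ℝ} (hU : 0 ≤ U)
    {ω : InfVolFermionState 2} (h : ω.IsVarEquilibrium β (gcInteractionTT'T'' t t' t'' U μ hz) 2) :
    β * t'' * ω.meanEnergy (axialRange2HoppingFermionInteraction 2 1) 2 ≤
      gcPressureTT'Zeeman β t t' U μ hz - (gcInteractionTT'T'' t t' t'' U μ hz).varPressure β 2 := by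
  have hm := h.mul_axialRange2Hopping_le_varPressure_sub 0
  rw [sub_zero, varPressure_gcInteractionTT'T''_zero, varPressure_gcInteractionTT'_two_eq hβ t t' hU μ hz] at hm
  exact hm

end InfVolFermionState

end Literature.MathematicalPhysics.QuantumLattice

end
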